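import Summits.BirchSwinnertonDyer.BirchSwinnertonDyer.Theorems.GenusKolyvaginAtTwoHeegnerValuationLedger
import HarnessLib

/-!
# Route `GenusKolyvaginAtTwo`: the Heegner valuation ledger at `2` WITHOUT the odd-Tamagawa / odd-Manin binders —
# `2·M₀ + ord₂#Ш(E)[2^∞] + ord₂#Ш(Wd)[2^∞] = ord₂#Ш_an(E) + ord₂#Ш_an(Wd) + ord₂#Ш(E_K)[2^∞] + 2·v₂(c) + 2·v₂(C(E))`

LEAD seat `bsd-line-gk2-p1` g26 (cell `bsd-f1-sign2`), sequel of `…HeegnerValuationLedger` (p781087).  THEOREMS ONLY (no definition, no named fact, no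
`sorry`); standard axioms.  **BSD is NOT proved by this file; no item is closed.**  CONDITIONAL on the route's four PRINT items (Gross–Zagier all levels,
GZK, modularity, Milne any-model), displayed as binders.

WHY.  `master_ledger` carries the habitat clauses `Odd C(E)` and `Odd c(Dt)`; several consumers sit OFF them — U₂'s reversed / even-Tamagawa frames
(gk2-p3 g28 `…SwappedPairHeegnerIndex` §3: `2 ∣ C(E)` forces `2 ∣ y_K`, computed ad hoc), the odd-Manin clause of the habitat itself, the swapped frames of
LINE 30/31.  Here the two `2`-powers are kept as explicit terms:
* §1 `padicValRat_shaAnOverC_heegner_anyTamagawa` — fkl g7's `RankOneAtTwoOneDoor.padicValRat_shaAnOverC_heegnerC` with the binder `Odd C(E)` REMOVED: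
  **`ord₂ #Ш_an(E_K) = 2·M₀ − 2·v₂(c) − 2·ord₂ C(E)`** (Gross–Zagier over `K`: `#Ш_an(E_K) = 4I²/(c² w_K² C(E)²)`, `w_K = 2`, `ord₂ I = M₀`); same proof.
* §2 `master_ledger_general` — **`2·M₀ + ord₂#Ш(E/ℚ)[2^∞] + ord₂#Ш(Wd/ℚ)[2^∞] = ord₂ qW + ord₂ qd + ord₂#Ш(E_K/K)[2^∞] + 2·v₂(c) + 2·ord₂ C(E)`** at every
  frame (`E` globally minimal of analytic rank `0`, `ρ̄_{E,2}` onto — NO Tamagawa / Manin parity; `K` imaginary quadratic, `d_K` odd `≠ −3`, Heegner;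
  ANY datum `Dt`; `2^(M₀) ∥ P(1)`; globally minimal twin of analytic rank `1` with `#Ш_an(Wd) = qd ∈ ℚ`; `#Ш_an(E) = qW ∈ ℚ` is returned).
READING: the Manin constant and the Tamagawa product of the rank-zero member shift the Heegner depth by exactly `v₂(c) + ord₂ C(E)` against the
BSD₂-defects; on the habitat (both odd) this is `master_ledger`.  Nothing about BSD is proved.

References: [GrossZagier1986] V §2 (2.2); [GrossLMS1991] §2 Conj. (2.2); [McCallumLMS1991] §5 Lemma 5.1; [Milne1972ArithmeticAV] §1 Thm. 1;
[DokchitserDokchitserAnnals2010] §2.1; [Miller2011LMS] Def. 1.1.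
-/

set_option autoImplicit false
set_option linter.dupNamespace false -- `Summit.<P>.<Sub>` repeats `BirchSwinnertonDyer` (D-0017)

noncomputable section

open scoped Classical

namespace Summit.BirchSwinnertonDyer.BirchSwinnertonDyer.Theorems.GenusExact.ValuationLedger

open WeierstrassCurve NumberField Literature.NumberTheory.EllipticCurves Literature.NumberTheory.EllipticCurves.ModularForms
  Literature.NumberTheory.EllipticCurves.Rank1Residual
  Literature.NumberTheory.EllipticCurves.Rank1Residual.Typed
  Literature.NumberTheory.EllipticCurves.KrizLi2019
  Literature.NumberTheory.GaloisRepresentations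
  Summit.BirchSwinnertonDyer.Rank1Residual
  Summit.BirchSwinnertonDyer.Rank1Residual.AdditivePotMult
  Summit.BirchSwinnertonDyer.Rank1Residual.F1Sign2
  Summit.BirchSwinnertonDyer.Rank1Residual.F1Sign2.TranspositionDoor
  Summit.BirchSwinnertonDyer.BirchSwinnertonDyer.Theses.ByReductionTypeAtTwo
  Summit.BirchSwinnertonDyer.BirchSwinnertonDyer.Theorems.CMExactDescent
  Summit.BirchSwinnertonDyer.BirchSwinnertonDyer.Theses.GenusKolyvaginAtTwo
  Summit.BirchSwinnertonDyer.BirchSwinnertonDyer.Theorems.RankOneAtTwoOneDoor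

/-! ## §1 Gross–Zagier over `K` for the rank-zero member, any Tamagawa product -/

/-- **`#Ш_an(W ⊗ K)` is a rational of `2`-adic valuation `2·M₀ − 2·v₂(c) − 2·ord₂ C(W)`** at any datum: `W` globally minimal with `ρ̄_{W,2}` onto (NO parity
hypothesis on `∏ c_ℓ`); `K` imaginary quadratic with odd `d_K ≠ −3` and the Heegner hypothesis; `Dt` any datum, `d₁` conductor-`1` with `2^(M₀) ∥ P(1)`;
`ord_{s=1} L(E_K, s) = 1`.  Also returned: `Ш(W ⊗ K)` is finite.  fkl g7's `padicValRat_shaAnOverC_heegnerC` verbatim with the Tamagawa valuation kept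
(Gross–Zagier `#Ш_an = 4I²/(c² w² (∏c)²)` via `CMExactDescent.shaAnOverC_baseChange_eq_of_heegner`, `w_K = 2`, `ord₂ I = M₀`).
[cite: GrossZagier1986, V.§2 (pp. 310–312)] [cite: McCallumLMS1991, §5 Lemma 5.1] -/
theorem padicValRat_shaAnOverC_heegner_anyTamagawa
    (W : WeierstrassCurve ℚ) [W.IsElliptic] [W.IsGloballyMinimal] [NeZero (W.conductorNorm ℤ)]
    (K : Type) [Field K] [NumberField K]
    (Dt : ModularParametrizationData W (W.conductorNorm ℤ)) (β : ℤ) (ι : K →+* ℂ) (d₁ : KolyvaginHeegnerData Dt β ι 1)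
    (hGZ : gross_zagier (W.conductorNorm ℤ) W K)
    (hGZK : rank_eq_analyticRank_of_analyticRank_le_one) (hmod : hasEntireLFunction_rat)
    (hρ : W.HasSurjectiveModNGaloisRep 2)
    (hK : IsImaginaryQuadratic K) (hodd : Odd (NumberField.discr K)) (h3 : NumberField.discr K ≠ -3)
    (hH : SatisfiesHeegnerHypothesis (W.conductorNorm ℤ) K)
    (hrK : (W.baseChange K).analyticRank = 1) {M₀ : ℕ}
    (hdiv : ∃ Q : (W.baseChange (ringClassField K ι 1)).toAffine.Point, ((2 ^ M₀ : ℕ) : ℤ) • Q = d₁.derivedPoint)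
    (hndiv : ¬ ∃ Q : (W.baseChange (ringClassField K ι 1)).toAffine.Point, ((2 ^ (M₀ + 1) : ℕ) : ℤ) • Q = d₁.derivedPoint) :
    (W.baseChange K).ShaFinite ∧
      ∃ q : ℚ, shaAnOverC (W.baseChange K) = (q : ℂ) ∧
        padicValRat 2 q = 2 * (M₀ : ℤ) - 2 * padicValInt 2 Dt.c - 2 * (padicValNat 2 W.tamagawaProduct : ℤ) := by
  haveI : Fact (Nat.Prime 2) := ⟨Nat.prime_two⟩
  haveI hEK : (W.baseChange K).IsElliptic := inferInstanceAs ((W.map (algebraMap ℚ K)).IsElliptic)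
  have h2 : Module.finrank ℚ K = 2 := hK.1
  obtain ⟨-, hDlt⟩ := discr_emod_four_and_lt_of_odd hK hodd h3
  have hw2 : Units.torsionOrder K = 2 :=
    Literature.NumberTheory.QuadraticFields.Quadratic.torsionOrder_eq_two_of_discr_lt_neg_four h2 hDlt
  have hc0 : Dt.c ≠ 0 := Dt.maninConstant_ne_zero_holds
  obtain ⟨P₀, Hd, hP₀, hP₀K⟩ := exists_heegnerPoint_map_eq_derivedPoint_one hK hH d₁
  obtain ⟨hrkK, hShaK, hPinf, hshaCx⟩ := shaAnOverC_baseChange_eq_of_heegner W K Dt Hd ι P₀ hGZ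
    hGZK hmod hK hH hP₀ hc0 hrK
  have htor1 : ∀ (M : ℕ) (R : (W.baseChange (ringClassField K ι 1)).toAffine.Point),
      ((2 ^ M : ℕ) : ℤ) • R = 0 → R = 0 :=
    fun M R hR ↦ eq_zero_of_two_pow_smul_eq_zero_ringClassField W hK hodd hH hρ ι M R hR
  have hdivK : ∃ Q : (W.baseChange K).toAffine.Point, ((2 ^ M₀ : ℕ) : ℤ) • Q = P₀ :=
    (X11b.Three.Koly.pDiv_one_iff_exists_zsmul_eq hK d₁ P₀ hP₀K 2 M₀ (htor1 M₀)).mp hdiv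
  have hndivK : ¬ ∃ Q : (W.baseChange K).toAffine.Point, ((2 ^ (M₀ + 1) : ℕ) : ℤ) • Q = P₀ :=
    fun h ↦ hndiv ((X11b.Three.Koly.pDiv_one_iff_exists_zsmul_eq hK d₁ P₀ hP₀K 2 (M₀ + 1)
      (htor1 (M₀ + 1))).mpr h)
  have hiv : ∀ x : (W.baseChange K).toAffine.Point, 2 • x = 0 → x = 0 :=
    fun x hx ↦ eq_zero_of_two_smul_eq_zero_baseChange W hK hodd hH hρ x hx
  haveI : Finite (AddCommGroup.torsion (W.baseChange K).toAffine.Point) :=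
    WeierstrassCurve.finite_torsion_point (W := W.baseChange K)
  obtain ⟨cc, Q, hcQ, hcker⟩ :=
    X11b.RankOne.exists_coord_of_mordellWeilRank_eq_one (W.baseChange K) hrkK
  have hidx : padicValNat 2 (AddSubgroup.zmultiples P₀).index = M₀ :=
    X11b.Three.Koly.padicValNat_index_zmultiples_eq_of_divisibility (p := 2) cc Q hcQ hcker hiv P₀
      hdivK hndivK
  set I := (AddSubgroup.zmultiples P₀).index with hI_def
  have hI0 : I ≠ 0 := fun hI ↦ by
    have hh := P2.torsionOrder_sq_mul_canonicalHeight_eq_index_sq_mul_regulator (W.baseChange K)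
      hrkK P₀ hPinf
    rw [← hI_def, hI, Nat.cast_zero, zero_pow two_ne_zero, zero_mul, mul_eq_zero,
      pow_eq_zero_iff two_ne_zero, Nat.cast_eq_zero] at hh
    exact hh.elim (W.baseChange K).torsionOrder_pos_holds.ne'
      (fun h0 ↦ hPinf ((Affine.Point.canonicalHeight_eq_zero_iff_holds P₀).mp h0))
  set q : ℚ := 4 * (I : ℚ) ^ 2 /
      ((Dt.c : ℚ) ^ 2 * (Units.torsionOrder K : ℚ) ^ 2 * ((W.tamagawaProduct : ℚ) ^ 2)) with hq_def
  have hcQ0 : (Dt.c : ℚ) ≠ 0 := by exact_mod_cast hc0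
  have hcW0 : (W.tamagawaProduct : ℚ) ≠ 0 := by exact_mod_cast W.tamagawaProduct_pos_holds.ne'
  have hIQ0 : (I : ℚ) ≠ 0 := by exact_mod_cast hI0
  have hq' : q = ((I : ℚ) / ((Dt.c : ℚ) * (W.tamagawaProduct : ℚ))) ^ 2 := by
    rw [hq_def, hw2]
    push_cast
    field_simp
    ring
  have hvc : padicValRat 2 (Dt.c : ℚ) = padicValInt 2 Dt.c := padicValRat.of_int
  have hvcW : padicValRat 2 (W.tamagawaProduct : ℚ) = padicValNat 2 W.tamagawaProduct := padicValRat.of_nat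
  have hvI : padicValRat 2 (I : ℚ) = padicValNat 2 I := padicValRat.of_nat
  refine ⟨hShaK, q, hshaCx, ?_⟩
  rw [hq', padicValRat.pow, padicValRat.div hIQ0 (mul_ne_zero hcQ0 hcW0), padicValRat.mul hcQ0 hcW0, hvc, hvcW, hvI, hidx]
  push_cast
  ring

/-! ## §2 The master ledger, any Tamagawa product and any Manin constant -/

/-- **THE HEEGNER VALUATION LEDGER AT `2`, general form (no parity on `C(E)` or `c`), modulo PRINT.**  `E = W/ℚ` globally minimal of analytic rank `0`
with `ρ̄_{E,2}` onto; `K` imaginary quadratic with `d_K` odd, `≠ −3`, Heegner for `N_E`; ANY datum `Dt` (Manin constant `c`), `d₁` conductor-`1` with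
`2^(M₀) ∥ P(1)`; `Wd` a globally minimal model of `E^(d_K)` of analytic rank `1` with `#Ш_an(Wd) = qd ∈ ℚ`.  Then `Ш(E/ℚ)`, `Ш(Wd/ℚ)`, `Ш(E_K/K)` are
finite, `#Ш_an(E) = qW ∈ ℚ`, and
**`2·M₀ + ord₂#Ш(E/ℚ)[2^∞] + ord₂#Ш(Wd/ℚ)[2^∞] = ord₂ qW + ord₂ qd + ord₂#Ш(E_K/K)[2^∞] + 2·v₂(c) + 2·ord₂ C(E)`.**
On the habitat (`c`, `C(E)` odd) this is `master_ledger`.  CONDITIONAL on the four print items; BSD is NOT proved by this.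
[cite: GrossZagier1986, V §2 (2.2)] [cite: McCallumLMS1991, §5 Lemma 5.1] [cite: Milne1972ArithmeticAV, §1 Thm. 1] [cite: DokchitserDokchitserAnnals2010, §2.1]
[cite: Miller2011LMS, Def. 1.1] -/
theorem master_ledger_general
    (hGZ : Theses.GenusKolyvaginAtTwo.GrossZagierAllLevels) (hGZK : Theses.GenusKolyvaginAtTwo.MultPublishedInputsAtTwo)
    (hL : Theses.GenusKolyvaginAtTwo.EntireLFunctionRat) (hMi : Theses.GenusKolyvaginAtTwo.MilneAnyModel)
    (W : WeierstrassCurve ℚ) [W.IsElliptic] [W.IsGloballyMinimal] [NeZero (W.conductorNorm ℤ)]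
    (hρ2 : W.HasSurjectiveModNGaloisRep 2) (hr0 : W.analyticRank = 0)
    (K : Type) [Field K] [NumberField K] (hIQ : IsImaginaryQuadratic K) (hodd : Odd (NumberField.discr K))
    (h3 : NumberField.discr K ≠ -3) (hHe : SatisfiesHeegnerHypothesis (W.conductorNorm ℤ) K)
    (Dt : ModularParametrizationData W (W.conductorNorm ℤ)) (β : ℤ) (ι : K →+* ℂ)
    (d₁ : KolyvaginHeegnerData Dt β ι 1) {M₀ : ℕ}
    (hdiv : ∃ Q : (W.baseChange (ringClassField K ι 1)).toAffine.Point, ((2 ^ M₀ : ℕ) : ℤ) • Q = d₁.derivedPoint)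
    (hndiv : ¬ ∃ Q : (W.baseChange (ringClassField K ι 1)).toAffine.Point, ((2 ^ (M₀ + 1) : ℕ) : ℤ) • Q = d₁.derivedPoint)
    (Wd : WeierstrassCurve ℚ) [Wd.IsElliptic] [Wd.IsGloballyMinimal]
    (hWd : ∃ C : VariableChange ℚ, C • W.quadraticTwist (NumberField.discr K : ℚ) = Wd) (hrd : Wd.analyticRank = 1)
    {qd : ℚ} (hqd : shaAn Wd = (qd : ℂ)) :
    Finite (↥W.sha) ∧ Finite (↥Wd.sha) ∧ Finite (↥(W.baseChange K).sha) ∧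
      ∃ qW : ℚ, shaAn W = (qW : ℂ) ∧
        2 * (M₀ : ℤ) + (padicValNat 2 (Nat.card (AddCommGroup.primaryComponent (↥W.sha) 2)) : ℤ) +
            (padicValNat 2 (Nat.card (AddCommGroup.primaryComponent (↥Wd.sha) 2)) : ℤ) =
          padicValRat 2 qW + padicValRat 2 qd +
            (padicValNat 2 (Nat.card (AddCommGroup.primaryComponent (↥(W.baseChange K).sha) 2)) : ℤ) +
            2 * padicValInt 2 Dt.c + 2 * (padicValNat 2 W.tamagawaProduct : ℤ) := by
  haveI : Fact (Nat.Prime 2) := ⟨Nat.prime_two⟩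
  haveI hEK : (W.baseChange K).IsElliptic := inferInstanceAs ((W.map (algebraMap ℚ K)).IsElliptic)
  have h2 : Module.finrank ℚ K = 2 := hIQ.1
  have hD0 : (NumberField.discr K : ℚ) ≠ 0 := by exact_mod_cast NumberField.discr_ne_zero K
  haveI hEt : (W.quadraticTwist (NumberField.discr K : ℚ)).IsElliptic := W.isElliptic_quadraticTwist hD0
  have hrt : (W.quadraticTwist (NumberField.discr K : ℚ)).analyticRank = 1 := by
    obtain ⟨Cd, hCd⟩ := hWd
    rw [← hrd, ← hCd, analyticRank_smul]
  have hrK : (W.baseChange K).analyticRank = 1 :=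
    (P2.analyticRank_baseChange_eq_one_iff W K hL h2).mpr (Or.inr ⟨hr0, hrt⟩)
  obtain ⟨hShaK, q', hq', hval⟩ :=
    padicValRat_shaAnOverC_heegner_anyTamagawa W K Dt β ι d₁ (hGZ _ W K) hGZK hL hρ2 hIQ hodd h3 hHe hrK hdiv hndiv
  obtain ⟨-, hfinW⟩ := hGZK W (by rw [hr0]; exact zero_le_one)
  obtain ⟨-, hfinD⟩ := hGZK Wd (by rw [hrd])
  haveI : Finite (↥W.sha) := hfinW
  haveI : Finite (↥Wd.sha) := hfinD
  haveI : Finite (↥(W.baseChange K).sha) := hShaK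
  have hV : ∃ C : VariableChange K, C • W.baseChange K = W.baseChange K := ⟨1, one_smul _ _⟩
  obtain ⟨-, hWR⟩ := hMi W K h2 Wd hWd (W.baseChange K) hV hfinW hfinD
  have hstar := shaAnOverC_mul_eq W K Wd (W.baseChange K) hL h2 hWd hV hfinW hfinD hWR
  obtain ⟨qW, hqW⟩ : ∃ qW : ℚ, shaAn W = (qW : ℂ) :=
    ⟨_, exists_shaAn_eq_of_overC W K Wd (W.baseChange K) hL h2 hWd hV hfinW hfinD hShaK hWR hq' hqd⟩
  have hsW : W.shaOrder ≠ 0 := (W.shaOrder_pos hfinW).ne'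
  have hsD : Wd.shaOrder ≠ 0 := (Wd.shaOrder_pos hfinD).ne'
  have hsK : (W.baseChange K).shaOrder ≠ 0 := ((W.baseChange K).shaOrder_pos hShaK).ne'
  have hqW0 : qW ≠ 0 := by
    intro h0; apply shaAn_ne_zero W hL; rw [hqW, h0, Rat.cast_zero]
  have hqd0 : qd ≠ 0 := by
    intro h0; apply shaAn_ne_zero Wd hL; rw [hqd, h0, Rat.cast_zero]
  have hQ : q' * W.shaOrder * Wd.shaOrder = qW * qd * (W.baseChange K).shaOrder := by
    have h : ((q' * W.shaOrder * Wd.shaOrder : ℚ) : ℂ) = ((qW * qd * (W.baseChange K).shaOrder : ℚ) : ℂ) := by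
      push_cast
      rw [← hqW, ← hq', ← hqd]
      exact hstar
    exact_mod_cast h
  have hsWq : (W.shaOrder : ℚ) ≠ 0 := by exact_mod_cast hsW
  have hsDq : (Wd.shaOrder : ℚ) ≠ 0 := by exact_mod_cast hsD
  have hsKq : ((W.baseChange K).shaOrder : ℚ) ≠ 0 := by exact_mod_cast hsK
  have hq'0 : q' ≠ 0 := by
    intro h0
    rw [h0, zero_mul, zero_mul] at hQ
    exact mul_ne_zero (mul_ne_zero hqW0 hqd0) hsKq hQ.symm
  have hv := congrArg (padicValRat 2) hQ
  rw [padicValRat.mul (mul_ne_zero hq'0 hsWq) hsDq, padicValRat.mul hq'0 hsWq,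
    padicValRat.mul (mul_ne_zero hqW0 hqd0) hsKq, padicValRat.mul hqW0 hqd0, hval,
    padicValRat.of_nat, padicValRat.of_nat, padicValRat.of_nat,
    X11b.Three.Koly.padicValNat_shaOrder_eq W 2, X11b.Three.Koly.padicValNat_shaOrder_eq Wd 2,
    X11b.Three.Koly.padicValNat_shaOrder_eq (W.baseChange K) 2] at hv
  refine ⟨hfinW, hfinD, hShaK, qW, hqW, ?_⟩
  linarith


/-! ## §3 (appended, same seat) The symmetric form: either member of the pair may carry the rank -/

/-- **THE LEDGER, SYMMETRIC IN THE RANKS** — as `master_ledger_general` but with the rank hypotheses replaced by `r_an(E) ≤ 1`, `r_an(Wd) ≤ 1` and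
`ord_{s=1} L(E_K, s) = 1` (so EITHER `E` has analytic rank `0` and the twin rank `1` — the supply frames — OR `E` has rank `1` and the twin rank `0` —
U₂'s REVERSED frames of LINE 23, where EXP±_all reads `M₀ = v₂(c) + ord₂ C(E)`):
**`2·M₀ + ord₂#Ш(E/ℚ)[2^∞] + ord₂#Ш(Wd/ℚ)[2^∞] = ord₂ qW + ord₂ qd + ord₂#Ш(E_K/K)[2^∞] + 2·v₂(c) + 2·ord₂ C(E)`.**  CONDITIONAL on the four print
items; BSD is NOT proved by this. [cite: GrossZagier1986, V §2 (2.2)] [cite: McCallumLMS1991, §5 Lemma 5.1] [cite: Milne1972ArithmeticAV, §1 Thm. 1]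
[cite: Miller2011LMS, Def. 1.1] -/
theorem master_ledger_symmetric
    (hGZ : Theses.GenusKolyvaginAtTwo.GrossZagierAllLevels) (hGZK : Theses.GenusKolyvaginAtTwo.MultPublishedInputsAtTwo)
    (hL : Theses.GenusKolyvaginAtTwo.EntireLFunctionRat) (hMi : Theses.GenusKolyvaginAtTwo.MilneAnyModel)
    (W : WeierstrassCurve ℚ) [W.IsElliptic] [W.IsGloballyMinimal] [NeZero (W.conductorNorm ℤ)]
    (hρ2 : W.HasSurjectiveModNGaloisRep 2) (hrW : W.analyticRank ≤ 1)
    (K : Type) [Field K] [NumberField K] (hIQ : IsImaginaryQuadratic K) (hodd : Odd (NumberField.discr K))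
    (h3 : NumberField.discr K ≠ -3) (hHe : SatisfiesHeegnerHypothesis (W.conductorNorm ℤ) K)
    (hrK : (W.baseChange K).analyticRank = 1)
    (Dt : ModularParametrizationData W (W.conductorNorm ℤ)) (β : ℤ) (ι : K →+* ℂ)
    (d₁ : KolyvaginHeegnerData Dt β ι 1) {M₀ : ℕ}
    (hdiv : ∃ Q : (W.baseChange (ringClassField K ι 1)).toAffine.Point, ((2 ^ M₀ : ℕ) : ℤ) • Q = d₁.derivedPoint)
    (hndiv : ¬ ∃ Q : (W.baseChange (ringClassField K ι 1)).toAffine.Point, ((2 ^ (M₀ + 1) : ℕ) : ℤ) • Q = d₁.derivedPoint)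
    (Wd : WeierstrassCurve ℚ) [Wd.IsElliptic] [Wd.IsGloballyMinimal]
    (hWd : ∃ C : VariableChange ℚ, C • W.quadraticTwist (NumberField.discr K : ℚ) = Wd) (hrd : Wd.analyticRank ≤ 1)
    {qd : ℚ} (hqd : shaAn Wd = (qd : ℂ)) :
    Finite (↥W.sha) ∧ Finite (↥Wd.sha) ∧ Finite (↥(W.baseChange K).sha) ∧
      ∃ qW : ℚ, shaAn W = (qW : ℂ) ∧
        2 * (M₀ : ℤ) + (padicValNat 2 (Nat.card (AddCommGroup.primaryComponent (↥W.sha) 2)) : ℤ) +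
            (padicValNat 2 (Nat.card (AddCommGroup.primaryComponent (↥Wd.sha) 2)) : ℤ) =
          padicValRat 2 qW + padicValRat 2 qd +
            (padicValNat 2 (Nat.card (AddCommGroup.primaryComponent (↥(W.baseChange K).sha) 2)) : ℤ) +
            2 * padicValInt 2 Dt.c + 2 * (padicValNat 2 W.tamagawaProduct : ℤ) := by
  haveI : Fact (Nat.Prime 2) := ⟨Nat.prime_two⟩
  haveI hEK : (W.baseChange K).IsElliptic := inferInstanceAs ((W.map (algebraMap ℚ K)).IsElliptic)
  have h2 : Module.finrank ℚ K = 2 := hIQ.1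
  obtain ⟨hShaK, q', hq', hval⟩ :=
    padicValRat_shaAnOverC_heegner_anyTamagawa W K Dt β ι d₁ (hGZ _ W K) hGZK hL hρ2 hIQ hodd h3 hHe hrK hdiv hndiv
  obtain ⟨-, hfinW⟩ := hGZK W hrW
  obtain ⟨-, hfinD⟩ := hGZK Wd hrd
  haveI : Finite (↥W.sha) := hfinW
  haveI : Finite (↥Wd.sha) := hfinD
  haveI : Finite (↥(W.baseChange K).sha) := hShaK
  have hV : ∃ C : VariableChange K, C • W.baseChange K = W.baseChange K := ⟨1, one_smul _ _⟩
  obtain ⟨-, hWR⟩ := hMi W K h2 Wd hWd (W.baseChange K) hV hfinW hfinD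
  have hstar := shaAnOverC_mul_eq W K Wd (W.baseChange K) hL h2 hWd hV hfinW hfinD hWR
  obtain ⟨qW, hqW⟩ : ∃ qW : ℚ, shaAn W = (qW : ℂ) :=
    ⟨_, exists_shaAn_eq_of_overC W K Wd (W.baseChange K) hL h2 hWd hV hfinW hfinD hShaK hWR hq' hqd⟩
  have hsW : W.shaOrder ≠ 0 := (W.shaOrder_pos hfinW).ne'
  have hsD : Wd.shaOrder ≠ 0 := (Wd.shaOrder_pos hfinD).ne'
  have hsK : (W.baseChange K).shaOrder ≠ 0 := ((W.baseChange K).shaOrder_pos hShaK).ne'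
  have hqW0 : qW ≠ 0 := by
    intro h0; apply shaAn_ne_zero W hL; rw [hqW, h0, Rat.cast_zero]
  have hqd0 : qd ≠ 0 := by
    intro h0; apply shaAn_ne_zero Wd hL; rw [hqd, h0, Rat.cast_zero]
  have hQ : q' * W.shaOrder * Wd.shaOrder = qW * qd * (W.baseChange K).shaOrder := by
    have h : ((q' * W.shaOrder * Wd.shaOrder : ℚ) : ℂ) = ((qW * qd * (W.baseChange K).shaOrder : ℚ) : ℂ) := by
      push_cast
      rw [← hqW, ← hq', ← hqd]
      exact hstar
    exact_mod_cast h
  have hsWq : (W.shaOrder : ℚ) ≠ 0 := by exact_mod_cast hsW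
  have hsDq : (Wd.shaOrder : ℚ) ≠ 0 := by exact_mod_cast hsD
  have hsKq : ((W.baseChange K).shaOrder : ℚ) ≠ 0 := by exact_mod_cast hsK
  have hq'0 : q' ≠ 0 := by
    intro h0
    rw [h0, zero_mul, zero_mul] at hQ
    exact mul_ne_zero (mul_ne_zero hqW0 hqd0) hsKq hQ.symm
  have hv := congrArg (padicValRat 2) hQ
  rw [padicValRat.mul (mul_ne_zero hq'0 hsWq) hsDq, padicValRat.mul hq'0 hsWq,
    padicValRat.mul (mul_ne_zero hqW0 hqd0) hsKq, padicValRat.mul hqW0 hqd0, hval,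
    padicValRat.of_nat, padicValRat.of_nat, padicValRat.of_nat,
    X11b.Three.Koly.padicValNat_shaOrder_eq W 2, X11b.Three.Koly.padicValNat_shaOrder_eq Wd 2,
    X11b.Three.Koly.padicValNat_shaOrder_eq (W.baseChange K) 2] at hv
  refine ⟨hfinW, hfinD, hShaK, qW, hqW, ?_⟩
  linarith

end Summit.BirchSwinnertonDyer.BirchSwinnertonDyer.Theorems.GenusExact.ValuationLedger

end
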